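import Summits.BirchSwinnertonDyer.BirchSwinnertonDyer.Theorems.ManinLocalTwoThreeCDivisionGamma1Stevens
import Summits.BirchSwinnertonDyer.BirchSwinnertonDyer.Theorems.ManinLocalTwoThreeCDivisionGrowth
import Summits.BirchSwinnertonDyer.BirchSwinnertonDyer.Theorems.ManinLocalTwoThreeCDivisionCuspSeries
import Summits.BirchSwinnertonDyer.BirchSwinnertonDyer.Theorems.ManinLocalTwoThreeCDivisionAssembly
import Summits.BirchSwinnertonDyer.BirchSwinnertonDyer.Theorems.ManinLocalTwoThreeCDivisionGamma1Transfer
import HarnessLib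

/-!
# Stevens' `c₁ = ±1` MODULO THE PRINTED CDT FACT ONLY (all analytic nodes discharged)

Cell `bsd-f2-manin`, prover seat p2 (gen 20); crux C2 `ManinOddAtFour` (stmt-BirchSwinnertonDyer-22967), `c`-division line (an g44 E-an-242;
nodes N1–N5 p2, N6–N7 + assembly p3, UDC/Wohlfahrt + transfer LEAD p1).

* `abs_maninConstant₁_eq_one_of_CDT` — **for every OPTIMAL `X₁(N)`-datum `D₁` of a globally minimal elliptic curve over `ℚ`, at every level:
  `|c₁| = 1`, conditionally on `CalegariDimitrovTang2025_unboundedDenominators_algInt` alone** (Stevens' conjecture `c_φ = ±1` [Stevens 1989, §2]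
  in conditional form).  Two kernel routes to the same statement: (i) `abs_maninConstant₁_eq_one_of_CDT_of_growth_of_cuspSeries'` (this seat) with
  (N6) := p3's `CDivGrowth.cDivGrowth` and (N7) := p3's `CDivCuspGerm.cDivCuspSeries`; (ii) LEAD's
  `CDivisionUDC.abs_maninConstant₁_eq_one_of_CDT_of_cDivisionWitnessLaw_of_datum` with E-an-242 := p3's `CDivAssembly.exists_cDivisionWitness` and
  the auxiliary `X₀`-datum from `nonempty_modularParametrizationData_of_gamma1`.  Both are recorded (`…_of_CDT`, `…_of_CDT'`).
* `natAbs_maninConstant_le_two_of_CDT` — hence for every `X₀(N)`-OPTIMAL datum at a level with `4 ∣ N` … is NOT restated here (see LEAD's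
  `CDivisionUDC.natAbs_maninConstant_le_two_of_CDT_of_cDivisionWitnessLaw` with p3's witness).

HONEST FRAMING: CONDITIONAL on the printed theorem of Calegari–Dimitrov–Tang (vendored as a named `Prop`, not proved in the tree).  Stevens' conjecture
is therefore NOT proved unconditionally here; Manin's conjecture, C2/C3 and BSD are NOT proved by this file.
[cite: Stevens1989, §2 (Conjecture: `c = ±1` for the `X₁(N)`-optimal curve)] [cite: CalegariDimitrovTang2025, Thm. 1.0.1 and Remarks 58–59]
[cite: Wohlfahrt1964, Thm. 2] [cite: Manin1972, Prop. 1.4] [cite: Honda1970, Thm. 9] [cite: ShimuraIATAF1971, Thm. 3.52 and Thm. 7.14]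
-/

set_option linter.dupNamespace false
set_option autoImplicit false

noncomputable section

open scoped MatrixGroups ModularForm Manifold

open Literature.NumberTheory.EllipticCurves Literature.NumberTheory.EllipticCurves.ModularForms

namespace Summit.BirchSwinnertonDyer.BirchSwinnertonDyer.Theorems.ManinLocalTwoThree.CDivision

/-- **Stevens' `|c₁| = 1` modulo CDT** (route (i): the `c₁`-division witness on the `X₁`-datum, nodes (N6)/(N7) by p3's theorems).
CONDITIONAL on the printed CDT fact; nothing about BSD. [cite: Stevens1989, §2] [cite: CalegariDimitrovTang2025, Thm. 1.0.1] -/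
theorem abs_maninConstant₁_eq_one_of_CDT
    (hCDT : Literature.NumberTheory.Automorphic.CalegariDimitrovTang2025_unboundedDenominators_algInt)
    {W : WeierstrassCurve ℚ} [W.IsElliptic] [W.IsGloballyMinimal] {N : ℕ} [NeZero N]
    (D₁ : Gamma1ParametrizationData W N) (hopt : D₁.IsOptimal) : |D₁.maninConstant| = 1 :=
  abs_maninConstant₁_eq_one_of_CDT_of_growth_of_cuspSeries' hCDT CDivGrowth.cDivGrowth CDivCuspGerm.cDivCuspSeries D₁ hopt

/-- **Stevens' `|c₁| = 1` modulo CDT** (route (ii): LEAD's transfer of the `X₀`-witness law E-an-242, discharged by p3's `exists_cDivisionWitness`;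
the `X₀`-datum supplied by `nonempty_modularParametrizationData_of_gamma1`).  CONDITIONAL on the printed CDT fact; nothing about BSD.
[cite: Stevens1989, §2] [cite: CalegariDimitrovTang2025, Thm. 1.0.1] -/
theorem abs_maninConstant₁_eq_one_of_CDT'
    (hCDT : Literature.NumberTheory.Automorphic.CalegariDimitrovTang2025_unboundedDenominators_algInt)
    {W : WeierstrassCurve ℚ} [W.IsElliptic] [W.IsGloballyMinimal] {N : ℕ} [NeZero N]
    (D₁ : Gamma1ParametrizationData W N) (hopt : D₁.IsOptimal) : |D₁.maninConstant| = 1 := by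
  obtain ⟨D⟩ := nonempty_modularParametrizationData_of_gamma1 D₁
  exact CDivisionUDC.abs_maninConstant₁_eq_one_of_CDT_of_cDivisionWitnessLaw_of_datum hCDT
    (fun W _ _ N _ D ↦ CDivAssembly.exists_cDivisionWitness W D) D D₁ hopt

end Summit.BirchSwinnertonDyer.BirchSwinnertonDyer.Theorems.ManinLocalTwoThree.CDivision

end
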